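import Summits.Ventures.HSemireg.WedgeHankelRecurrenceGaussChebyshevDerivativesMinimum

/-!
# Venture HSemireg — **TWO BINOMIAL ∕ ODD-FACTORIAL IDENTITIES READ OFF THE CHEBYSHEV DERIVATIVES AT `1`: `(∏_{l<k}(2l+3))·k!·2^k·C(n+1+k, 2k+1) = (n+1)·∏_{l<k}((n+1)² − (l+1)²)` and
# `(∏_{l<k}(2l+1))·k!·2^k·(C(n+1+k, 2k) + C(n+k, 2k)) = 2·∏_{l<k}((n+1)² − l²)` in `ℤ`** (Mathlib's product forms `iterate_derivative_U ∕ T_eval_one` of Rivlin's (1.97)–(1.98) COMPARED with the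
# binomial forms of N551 for the same numbers `U_n^{(k)}(1)`, `2T_{n+1}^{(k)}(1)`; i.e. `(2k+1)!!·k!·2^k·C(n+1+k,2k+1)·… ` — the consistency check of N551 against Mathlib, recorded as arithmetic)

HONEST FRAMING. Part of the Lean index of the computation cell `pub-hsemireg` (seat p10 gen 49, Sunday typer «UNIFORM-IN-n»).  Integer arithmetic obtained by evaluating polynomial identities in `ℤ[X]` (Mathlib
`Polynomial.Chebyshev.T ∕ U`, `Polynomial.derivative`, `Nat.choose`, `Finset.prod`); no variety, no cohomology theory, no sheaf, no Ext group and no semiregularity map is constructed here; nothing here says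
that HC / HC_CM / HC_AV holds; no Literature fact (unproved `Prop`) is declared or used.  Custodian versions as in `WedgeHankelSiegelIdeal` (1/3).
SOURCES (cited).  T. J. Rivlin, *The Chebyshev Polynomials* (Wiley 1974), §1.5 (1.97)–(1.98); NIST DLMF 18.9.21; H. W. Gould, *Combinatorial Identities* (1972) (odd-factorial ∕ central-binomial conversions).
PROOF TYPED HERE.  Specialise Mathlib `iterate_derivative_U_eval_one ∕ iterate_derivative_T_eval_one` to `R = ℤ`, substitute N551 `iterate_derivative_chebyshevU_eval_one_eq_choose ∕
two_mul_iterate_derivative_chebyshevT_eval_one_eq_choose`, normalise casts.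
DEDUP DISCLOSURE (`rg -n '2 \\* l \\+ 3|2 \\* l \\+ 1\\)\\) \\*' Summits/Ventures/HSemireg Literature Mathlib…Chebyshev.lean`, 2026-09-05): only Mathlib's two product theorems (USED); the binomial comparison is not
typed anywhere; 0 hits for the 2 names below.

WHAT IS IN THE TREE.  Mathlib `Polynomial.Chebyshev.iterate_derivative_U_eval_one`, `iterate_derivative_T_eval_one`; N551 `iterate_derivative_chebyshevU_eval_one_eq_choose`,
`two_mul_iterate_derivative_chebyshevT_eval_one_eq_choose`.
THIS FILE (namespace `Summit.Ventures.HSemireg.Wedge.HankelOuter` continued; CHAINED on N553; 0 definitions):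
* §1319 **`prod_two_mul_add_three_mul_choose`** (`(∏_{l<k}(2l+3))·k!·2^k·C(n+1+k,2k+1) = (n+1)·∏_{l<k}((n+1)² − (l+1)²)`), **`prod_two_mul_add_one_mul_choose`**
  (`(∏_{l<k}(2l+1))·k!·2^k·(C(n+1+k,2k) + C(n+k,2k)) = 2·∏_{l<k}((n+1)² − l²)`), both in `ℤ`, all `n, k ∈ ℕ`.
CAVEATS.  Stated in `ℤ` (for `k > n` both sides vanish: a zero factor on the right, a zero binomial on the left).  Nothing Ext-side.  New names only.
-/

open Module Polynomial
open scoped Matrix Polynomial Nat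

namespace Summit.Ventures.HSemireg.Wedge.HankelOuter

/-! ## §1319. Odd-factorial identities from `U_n^{(k)}(1)` and `T_n^{(k)}(1)` -/

/-- **`(∏_{l<k}(2l+3))·k!·2^k·C(n+1+k, 2k+1) = (n+1)·∏_{l<k}((n+1)² − (l+1)²)`** in `ℤ` (both sides are `(∏_{l<k}(2l+3))·U_n^{(k)}(1)`: Mathlib's product form against N551's binomial form).
[Rivlin 1974, (1.98); this file, §1319] -/
theorem prod_two_mul_add_three_mul_choose (n k : ℕ) :
    (∏ l ∈ Finset.range k, (2 * (l : ℤ) + 3)) * ((k ! * 2 ^ k * (n + 1 + k).choose (2 * k + 1) : ℕ) : ℤ) =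
      (∏ l ∈ Finset.range k, (((n : ℤ) + 1) ^ 2 - ((l : ℤ) + 1) ^ 2)) * ((n : ℤ) + 1) := by
  have h1 := Polynomial.Chebyshev.iterate_derivative_U_eval_one (R := ℤ) (n : ℤ) k
  rw [iterate_derivative_chebyshevU_eval_one_eq_choose] at h1
  exact_mod_cast h1

/-- **`(∏_{l<k}(2l+1))·k!·2^k·(C(n+1+k, 2k) + C(n+k, 2k)) = 2·∏_{l<k}((n+1)² − l²)`** in `ℤ` (both sides are `(∏_{l<k}(2l+1))·2T_{n+1}^{(k)}(1)`). [Rivlin 1974, (1.97); this file, §1319] -/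
theorem prod_two_mul_add_one_mul_choose (n k : ℕ) :
    (∏ l ∈ Finset.range k, (2 * (l : ℤ) + 1)) * ((k ! * 2 ^ k * ((n + 1 + k).choose (2 * k) + (n + k).choose (2 * k)) : ℕ) : ℤ) =
      2 * ∏ l ∈ Finset.range k, ((((n + 1 : ℕ) : ℤ)) ^ 2 - (l : ℤ) ^ 2) := by
  have h1 := Polynomial.Chebyshev.iterate_derivative_T_eval_one (R := ℤ) ((n + 1 : ℕ) : ℤ) k
  have h2 := two_mul_iterate_derivative_chebyshevT_eval_one_eq_choose (R := ℤ) n k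
  push_cast at h1 h2 ⊢
  linear_combination (-(∏ l ∈ Finset.range k, (2 * (l : ℤ) + 1))) * h2 + 2 * h1

end Summit.Ventures.HSemireg.Wedge.HankelOuter
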